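import Mathlib
import Literature.MathematicalPhysics.QuantumFieldTheory.Balaban1983to89.T4OutputRate

/-!
# T⁴ programme, SUBSTRATE (shared lattice-gauge analysis library) — MULTISCALE WEIGHTED-SUP BALLS on tables over the carriers of
# node U3: the `κ`-ball `WBound C κ M k t` («`|t X| ≤ M·e^{−κ d X}` on the scale-`k` domains»), its algebra, the ANCHORED SHELL SUM
# with the TRUE constant `M·C₀·e^{κ₀}·e/(e − 1)`, and the bridge to `T4OutputRate.DecayBound` (map item S-NRM)

Substrate cell `b2b-balaban-substrate-*`, seat p3, map item **S-NRM** of `substrate/SUBSTRATE-MAP.md` §2 (typer sketch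
`substrate/typer/SubstrateSketch.v0.1.lean` §L3, decls `WBound`, `WBoundAlgebra_stmt`, `WBoundAnchoredSum_stmt`).  The NE rows (NE5 `T4OutputRate.NE5`,
NE9 `T4OutputRate.NE9`, NE7's term ledgers) all quantify tables `t : C.Dom → ℝ` over the carriers `C : T4OutputRate.Carriers` (domains `X` with a
creation scale `C.scale X` and a tree length `C.d X ≥ 0`) by the printed decay shape `|E^{(j)}(X)| ≤ E₀e^{−κd_j(X)}` ([Balaban1987RG1] (0.25) p.257 ∕
(1.18) p.263 — the SHAPE only; `T4OutputRate.DecayBound`).  This file is the norm algebra of that shape, once, for every row: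

 * §1 **`WBound C κ M k t`** `:= ∀ X, C.scale X = k → |t X| ≤ M·exp(−κ·C.d X)` (the sketch's definition, verbatim) and its algebra:
   `WBound.mono_const`, `WBound.mono_rate` (`κ′ ≤ κ`, `0 ≤ M`: the ball grows as the rate drops, since `d ≥ 0`), `WBound.add` (constants add),
   `WBound.mul` (RATES ADD, constants multiply), `WBound.smul`, `WBound.neg`, `WBound.sub`, `WBound.zero`, `WBound.nonneg` (a nonempty scale forces
   `0 ≤ M`), `WBound.sum` (finite sums), and the sketch's conjunction **`wBound_algebra`** (= `WBoundAlgebra_stmt`, PROVED);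
 * §2 the bridge **`decayBound_iff_wBound`**: `T4OutputRate.DecayBound E W E₀ κ ↔ ∀ g ∈ W, ∀ U k, WBound C κ E₀ k (E g U)`;
 * §3 the ANCHORED SHELL SUM (the one place geometry enters, through an abstract catalogue-growth hypothesis of the [II] (1.26)-shape
   `#{X ∈ cat k : d X ≤ n} ≤ C₀·e^{κ₀n}`): **`wBound_anchoredSum`** — if moreover every `X ∈ cat k` has scale `k` and `κ ≥ κ₀ + 1`, `0 ≤ M`,
   then `Σ_{X ∈ cat k} |t X| ≤ M·C₀·e^{κ₀}·(e/(e − 1))`.  TRUE FORM of the sketch's `WBoundAnchoredSum_stmt`, which (i) omitted the scale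
   hypothesis `∀ X ∈ cat k, C.scale X = k` (without it the statement is false: `WBound … k t` does not bind `t` off scale `k`) and (ii) the
   factor `e^{κ₀}` (the shell `{n ≤ d X < n + 1}` is only counted by the catalogue bound at radius `n + 1`); proof: floor shells
   `n_X = ⌊d X⌋₊`, `e^{−κ d X} ≤ e^{−κ n_X}`, fibrewise count `≤ C₀e^{κ₀(n_X+1)}`, geometric tail `Σ_n e^{−(κ−κ₀)n} ≤ Σ_n e^{−n} = e/(e−1)`.

HONEST FRAMING (T4-DAG p. 1).  Pure bookkeeping over the abstract carriers (real analysis on finite sums); NO estimate of any NE row, nothing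
printed is a hypothesis or a conclusion; no `def … : Prop` fact (the one `def` is the norm ball `WBound`, DATA); spine 0/9 unchanged; NOT
infinite volume ∕ mass gap ∕ Clay.  HONEST DEPENDENCY: continuum YM on T⁴ ⇐ BetaPertH ∧ nine spine estimates (0/9 proved); BetaPertH ⇐ (D1) ∧
(D4) ∧ CAP+tail; G-an2-4 gates asym, D1 and NE2/3/4.  ABSOLUTE RULE kept; no `sorry`.
-/

noncomputable section

open scoped BigOperators

namespace Summit.QuantumFields.BalabanUV.T4Continuum.SubstrateNorms

open Literature.MathematicalPhysics.QuantumFieldTheory.Balaban1983to89.T4OutputRate (Carriers Functional DecayBound)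

/-! ## §1 The scale-`k` weighted-sup ball and its algebra -/

/-- **the scale-`k` weighted-sup ball**: `|t X| ≤ M·e^{−κ d X}` for every domain `X` of scale `k` (the decay SHAPE (0.25) p.257 ∕ (1.18) p.263
of Bałaban's RG-I paper, read as a norm ball on tables over the carriers — a PREDICATE on data, no printed content; the typer's sketch `WBound`,
verbatim). [folklore] -/
def WBound (C : Carriers) (κ M : ℝ) (k : ℕ) (t : C.Dom → ℝ) : Prop :=
  ∀ X, C.scale X = k → |t X| ≤ M * Real.exp (-(κ * C.d X))

namespace WBound

variable {C : Carriers} {κ κ' M M' : ℝ} {k : ℕ} {t s : C.Dom → ℝ}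

/-- monotonicity in the constant. [folklore] -/
theorem mono_const (h : WBound C κ M k t) (hM : M ≤ M') : WBound C κ M' k t := fun X hX =>
  (h X hX).trans (mul_le_mul_of_nonneg_right hM (Real.exp_pos _).le)

/-- monotonicity in the rate: a `κ`-ball is a `κ′`-ball for `κ′ ≤ κ` (`d ≥ 0`), provided `0 ≤ M`. [folklore] -/
theorem mono_rate (h : WBound C κ M k t) (hκ : κ' ≤ κ) (hM : 0 ≤ M) : WBound C κ' M k t := fun X hX =>
  (h X hX).trans (mul_le_mul_of_nonneg_left (Real.exp_le_exp.mpr (by nlinarith [C.d_nonneg X])) hM)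

/-- sums: constants add. [folklore] -/
theorem add (ht : WBound C κ M k t) (hs : WBound C κ M' k s) : WBound C κ (M + M') k (t + s) := fun X hX => by
  rw [Pi.add_apply, add_mul]
  exact (abs_add_le _ _).trans (add_le_add (ht X hX) (hs X hX))

/-- a ball that binds at least one domain has `0 ≤ M`. [folklore] -/
theorem nonneg (ht : WBound C κ M k t) {X : C.Dom} (hX : C.scale X = k) : 0 ≤ M :=
  le_of_mul_le_mul_right (by rw [zero_mul]; exact (abs_nonneg _).trans (ht X hX)) (Real.exp_pos (-(κ * C.d X)))

/-- pointwise products: RATES ADD, constants multiply. [folklore] -/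
theorem mul (ht : WBound C κ M k t) (hs : WBound C κ' M' k s) : WBound C (κ + κ') (M * M') k (t * s) := fun X hX => by
  have hM : 0 ≤ M := ht.nonneg hX
  rw [Pi.mul_apply, abs_mul, show M * M' * Real.exp (-((κ + κ') * C.d X)) = (M * Real.exp (-(κ * C.d X))) * (M' * Real.exp (-(κ' * C.d X))) by
    rw [show -((κ + κ') * C.d X) = -(κ * C.d X) + -(κ' * C.d X) by ring, Real.exp_add]; ring]
  exact mul_le_mul (ht X hX) (hs X hX) (abs_nonneg _) (mul_nonneg hM (Real.exp_pos _).le)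

/-- scalar multiples. [folklore] -/
theorem smul (ht : WBound C κ M k t) (c : ℝ) : WBound C κ (|c| * M) k (c • t) := fun X hX => by
  rw [Pi.smul_apply, smul_eq_mul, abs_mul, mul_assoc]
  exact mul_le_mul_of_nonneg_left (ht X hX) (abs_nonneg c)

/-- negation. [folklore] -/
theorem neg (ht : WBound C κ M k t) : WBound C κ M k (-t) := fun X hX => by
  rw [Pi.neg_apply, abs_neg]; exact ht X hX

/-- differences: constants add. [folklore] -/
theorem sub (ht : WBound C κ M k t) (hs : WBound C κ M' k s) : WBound C κ (M + M') k (t - s) := by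
  rw [sub_eq_add_neg]; exact ht.add hs.neg

/-- the zero table lies in every ball with `0 ≤ M`. [folklore] -/
theorem zero (hM : 0 ≤ M) : WBound C κ M k (0 : C.Dom → ℝ) := fun X _ => by
  rw [Pi.zero_apply, abs_zero]; positivity

/-- pointwise domination passes the ball. [folklore] -/
theorem of_abs_le (ht : WBound C κ M k t) (h : ∀ X, C.scale X = k → |s X| ≤ |t X|) : WBound C κ M k s := fun X hX =>
  (h X hX).trans (ht X hX)

/-- finite sums of tables: constants add up. [folklore] -/
theorem sum {ι : Type*} (S : Finset ι) {f : ι → C.Dom → ℝ} {Mf : ι → ℝ} (h : ∀ i ∈ S, WBound C κ (Mf i) k (f i)) :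
    WBound C κ (∑ i ∈ S, Mf i) k (fun X => ∑ i ∈ S, f i X) := by
  classical
  induction S using Finset.induction_on with
  | empty => intro X _; simp
  | @insert i S hi ih =>
    intro X hX
    show |∑ j ∈ insert i S, f j X| ≤ _
    rw [Finset.sum_insert hi, Finset.sum_insert hi, add_mul]
    have h1 := h i (Finset.mem_insert_self i S) X hX
    have h2 := ih (fun j hj => h j (Finset.mem_insert_of_mem hj)) X hX
    exact (abs_add_le _ _).trans (add_le_add h1 h2)

end WBound

/-- **the sketch's `WBoundAlgebra_stmt`, PROVED**: sums (constants add), products (rates add, constants multiply), `κ`-monotonicity. [folklore] -/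
theorem wBound_algebra (C : Carriers) (κ κ' M M' : ℝ) (k : ℕ) (t s : C.Dom → ℝ) :
    (WBound C κ M k t → WBound C κ M' k s → WBound C κ (M + M') k (t + s)) ∧
    (WBound C κ M k t → WBound C κ' M' k s → WBound C (κ + κ') (M * M') k (t * s)) ∧
    (κ' ≤ κ → 0 ≤ M → WBound C κ M k t → WBound C κ' M k t) :=
  ⟨fun ht hs => ht.add hs, fun ht hs => ht.mul hs, fun hκ hM ht => ht.mono_rate hκ hM⟩

/-! ## §2 The bridge to `T4OutputRate.DecayBound` -/

/-- **`DecayBound` is `WBound` at every scale**: `DecayBound E W E₀ κ ↔ ∀ g ∈ W, ∀ U k, WBound C κ E₀ k (E g U)` (every domain has a scale).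
[folklore] -/
theorem decayBound_iff_wBound {C : Carriers} {Bg : Type} (E : Functional C Bg) (W : Set (ℕ → ℝ)) (E₀ κ : ℝ) :
    DecayBound E W E₀ κ ↔ ∀ g ∈ W, ∀ (U : Bg) (k : ℕ), WBound C κ E₀ k (E g U) :=
  ⟨fun h g hg U _ X _ => h g hg U X, fun h g hg U X => h g hg U (C.scale X) X rfl⟩

/-- the one-scale reading: a `DecayBound` functional is in the `κ`-ball of constant `E₀` at every scale. [folklore] -/
theorem wBound_of_decayBound {C : Carriers} {Bg : Type} {E : Functional C Bg} {W : Set (ℕ → ℝ)} {E₀ κ : ℝ} (h : DecayBound E W E₀ κ)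
    {g : ℕ → ℝ} (hg : g ∈ W) (U : Bg) (k : ℕ) : WBound C κ E₀ k (E g U) :=
  (decayBound_iff_wBound E W E₀ κ).mp h g hg U k

/-! ## §3 The anchored shell sum -/

/-- a finite sum of `r^n` over distinct naturals is at most the geometric series `(1 − r)⁻¹` (`0 ≤ r < 1`). [folklore] -/
theorem sum_pow_le_inv_one_sub (S : Finset ℕ) {r : ℝ} (hr0 : 0 ≤ r) (hr1 : r < 1) : ∑ n ∈ S, r ^ n ≤ (1 - r)⁻¹ := by
  have hs : Summable fun n : ℕ => r ^ n := summable_geometric_of_lt_one hr0 hr1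
  calc ∑ n ∈ S, r ^ n ≤ ∑' n : ℕ, r ^ n := hs.sum_le_tsum S (fun n _ => pow_nonneg hr0 n)
    _ = (1 - r)⁻¹ := tsum_geometric_of_lt_one hr0 hr1

/-- `(1 − e^{−1})⁻¹ = e/(e − 1)`. [folklore] -/
theorem inv_one_sub_exp_neg_one : (1 - Real.exp (-1))⁻¹ = Real.exp 1 / (Real.exp 1 - 1) := by
  have he : 0 < Real.exp 1 := Real.exp_pos 1
  have he1 : 0 < Real.exp 1 - 1 := by linarith [Real.add_one_le_exp (1 : ℝ)]
  rw [Real.exp_neg, show 1 - (Real.exp 1)⁻¹ = (Real.exp 1 - 1) / Real.exp 1 by field_simp, inv_div]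

/-- **THE ANCHORED SHELL SUM (TRUE FORM of the sketch's `WBoundAnchoredSum_stmt`)**.  Let `cat : ℕ → Finset C.Dom` be a catalogue of scale-`k`
domains (`∀ X ∈ cat k, C.scale X = k` — e.g. the domains of scale `k` containing a fixed point) with the [II] (1.26)-SHAPE growth
`#{X ∈ cat k : d X ≤ n} ≤ C₀·e^{κ₀n}` for all `n : ℕ`, `κ₀ ≥ 0`.  If `κ₀ + 1 ≤ κ` and `0 ≤ M`, every table in the scale-`k` `κ`-ball has
`Σ_{X ∈ cat k} |t X| ≤ M·C₀·e^{κ₀}·(e/(e − 1))`.  (The sketch omitted the scale hypothesis — without which the statement is false, `WBound … k t`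
binding `t` only on scale `k` — and the factor `e^{κ₀}`: the shell `{n ≤ d X < n + 1}` is counted by the catalogue bound at radius `n + 1`.)
[cite: Balaban1988RG2Cluster, (1.26) p.8 (shape of the anchored sum ∕ catalogue growth only; cf. [Balaban1987RG1] (0.26) p.257)] [folklore] -/
theorem wBound_anchoredSum (C : Carriers) (cat : ℕ → Finset C.Dom) {κ₀ C₀ : ℝ} (hκ₀ : 0 ≤ κ₀)
    (hcat : ∀ k (n : ℕ), (((cat k).filter (fun X => C.d X ≤ n)).card : ℝ) ≤ C₀ * Real.exp (κ₀ * n))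
    {κ M : ℝ} (hκ : κ₀ + 1 ≤ κ) (hM : 0 ≤ M) (k : ℕ) (hsc : ∀ X ∈ cat k, C.scale X = k) (t : C.Dom → ℝ) (ht : WBound C κ M k t) :
    ∑ X ∈ cat k, |t X| ≤ M * C₀ * Real.exp κ₀ * (Real.exp 1 / (Real.exp 1 - 1)) := by
  classical
  have hκ1 : 1 ≤ κ := by linarith
  -- `C₀ ≥ 0` (the growth bound at radius `0` dominates a cardinality)
  have hC₀ : 0 ≤ C₀ := by
    have h0 : (0 : ℝ) ≤ (((cat k).filter (fun X => C.d X ≤ ((0 : ℕ) : ℝ))).card : ℝ) := Nat.cast_nonneg _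
    exact le_of_mul_le_mul_right (by rw [zero_mul]; exact h0.trans (hcat k 0)) (Real.exp_pos _)
  set fl : C.Dom → ℕ := fun X => ⌊C.d X⌋₊ with hfl
  set r : ℝ := Real.exp (-1) with hr
  have hr0 : 0 ≤ r := (Real.exp_pos _).le
  have hr1 : r < 1 := Real.exp_lt_one_iff.mpr (by norm_num)
  -- (a) termwise: `|t X| ≤ M e^{−κ n_X}`, `n_X = ⌊d X⌋`
  have hterm : ∀ X ∈ cat k, |t X| ≤ M * Real.exp (-(κ * (fl X : ℝ))) := fun X hX =>
    (ht X (hsc X hX)).trans (mul_le_mul_of_nonneg_left (Real.exp_le_exp.mpr (by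
      have h1 : (fl X : ℝ) ≤ C.d X := Nat.floor_le (C.d_nonneg X)
      nlinarith)) hM)
  -- (b) the fibre of the shell `n` is counted by the catalogue bound at radius `n + 1`
  have hfib : ∀ n : ℕ, (((cat k).filter (fun X => fl X = n)).card : ℝ) ≤ C₀ * Real.exp (κ₀ * ((n : ℝ) + 1)) := by
    intro n
    have hsub : (cat k).filter (fun X => fl X = n) ⊆ (cat k).filter (fun X => C.d X ≤ ((n + 1 : ℕ) : ℝ)) := by
      intro X hX
      rw [Finset.mem_filter] at hX ⊢
      refine ⟨hX.1, ?_⟩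
      have h1 : C.d X < (fl X : ℝ) + 1 := Nat.lt_floor_add_one (C.d X)
      rw [hX.2] at h1
      push_cast
      exact h1.le
    calc (((cat k).filter (fun X => fl X = n)).card : ℝ) ≤ (((cat k).filter (fun X => C.d X ≤ ((n + 1 : ℕ) : ℝ))).card : ℝ) := by
          exact_mod_cast Finset.card_le_card hsub
      _ ≤ C₀ * Real.exp (κ₀ * ((n + 1 : ℕ) : ℝ)) := hcat k (n + 1)
      _ = C₀ * Real.exp (κ₀ * ((n : ℝ) + 1)) := by push_cast; ring_nf
  -- (c) per shell: `e^{κ₀(n+1)}·e^{−κn} ≤ e^{κ₀}·r^n` (`κ − κ₀ ≥ 1`)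
  have hexp : ∀ n : ℕ, Real.exp (κ₀ * ((n : ℝ) + 1)) * Real.exp (-(κ * n)) ≤ Real.exp κ₀ * r ^ n := by
    intro n
    rw [hr, ← Real.exp_nat_mul, ← Real.exp_add, ← Real.exp_add]
    refine Real.exp_le_exp.mpr ?_
    have hn : (0 : ℝ) ≤ n := Nat.cast_nonneg n
    nlinarith
  -- (d) assemble through the floor fibration
  have hmaps : ∀ X ∈ cat k, fl X ∈ (cat k).image fl := fun X hX => Finset.mem_image_of_mem fl hX
  calc ∑ X ∈ cat k, |t X| ≤ ∑ X ∈ cat k, M * Real.exp (-(κ * (fl X : ℝ))) := Finset.sum_le_sum hterm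
    _ = ∑ n ∈ (cat k).image fl, ∑ X ∈ (cat k).filter (fun X => fl X = n), M * Real.exp (-(κ * (n : ℝ))) :=
        (Finset.sum_fiberwise_of_maps_to' hmaps (fun n : ℕ => M * Real.exp (-(κ * (n : ℝ))))).symm
    _ = ∑ n ∈ (cat k).image fl, (((cat k).filter (fun X => fl X = n)).card : ℝ) * (M * Real.exp (-(κ * (n : ℝ)))) := by
        refine Finset.sum_congr rfl fun n _ => ?_
        rw [Finset.sum_const, nsmul_eq_mul]
    _ ≤ ∑ n ∈ (cat k).image fl, C₀ * Real.exp (κ₀ * ((n : ℝ) + 1)) * (M * Real.exp (-(κ * (n : ℝ)))) :=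
        Finset.sum_le_sum fun n _ => mul_le_mul_of_nonneg_right (hfib n) (by positivity)
    _ = M * C₀ * ∑ n ∈ (cat k).image fl, Real.exp (κ₀ * ((n : ℝ) + 1)) * Real.exp (-(κ * (n : ℝ))) := by
        rw [Finset.mul_sum]; exact Finset.sum_congr rfl fun n _ => by ring
    _ ≤ M * C₀ * ∑ n ∈ (cat k).image fl, Real.exp κ₀ * r ^ n :=
        mul_le_mul_of_nonneg_left (Finset.sum_le_sum fun n _ => hexp n) (by positivity)
    _ = M * C₀ * Real.exp κ₀ * ∑ n ∈ (cat k).image fl, r ^ n := by rw [← Finset.mul_sum]; ring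
    _ ≤ M * C₀ * Real.exp κ₀ * (1 - r)⁻¹ :=
        mul_le_mul_of_nonneg_left (sum_pow_le_inv_one_sub _ hr0 hr1) (by positivity)
    _ = M * C₀ * Real.exp κ₀ * (Real.exp 1 / (Real.exp 1 - 1)) := by rw [hr, inv_one_sub_exp_neg_one]

end Summit.QuantumFields.BalabanUV.T4Continuum.SubstrateNorms

end
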